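import Mathlib

/-!
# SoloBlind — HIDDEN COVER (partial linear space) summation lemma.
solo-HodgeConjecture-blind s42, type1-imprimitive.md §10 (LEMMA PLS), CLAIMS SB-C325.

Combinatorial core of the "hidden cover" computation: if `lines` is a family of finite
subsets of `α` in which two distinct points lie on AT MOST ONE common line (a partial
linear space), then summing a two-point function over the ordered off-diagonal pairs of
every line equals summing it over all COLLINEAR ordered pairs — each collinear pair is
counted exactly once.  With a bilinear-type double sum whose diagonal terms vanish
("a 2-form pulled back from a curve is zero"), the full line-by-line double sum equals the
collinear sum; this is the identity behind
`Σ_{O ⊂ O_𝓛} Θ_O(α ⊠ β) = tr_{Z_𝓛/X}(T_𝓛 α ∧ T_𝓛 β)`.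
-/


namespace Summit.HodgeConjecture.HodgeConjecture.Theorems.HiddenCover

open Finset

variable {α : Type*} [DecidableEq α] {M : Type*} [AddCommMonoid M]

/-- A family of lines is a *partial linear space* when two distinct points lie on at most
one common line. -/
def IsPartialLinearSpace (lines : Finset (Finset α)) : Prop :=
  ∀ L₁ ∈ lines, ∀ L₂ ∈ lines, ∀ a b : α, a ≠ b → a ∈ L₁ → b ∈ L₁ → a ∈ L₂ → b ∈ L₂ → L₁ = L₂

/-- The collinear ordered off-diagonal pairs: the union of the off-diagonals of the lines. -/
def collinearPairs (lines : Finset (Finset α)) : Finset (α × α) :=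
  lines.biUnion Finset.offDiag

/-- Membership in `collinearPairs`: distinct points lying on a common line. -/
theorem mem_collinearPairs {lines : Finset (Finset α)} {p : α × α} :
    p ∈ collinearPairs lines ↔ p.1 ≠ p.2 ∧ ∃ L ∈ lines, p.1 ∈ L ∧ p.2 ∈ L := by
  unfold collinearPairs
  simp only [Finset.mem_biUnion, Finset.mem_offDiag]
  constructor
  · rintro ⟨L, hL, h1, h2, hne⟩
    exact ⟨hne, L, hL, h1, h2⟩
  · rintro ⟨hne, L, hL, h1, h2⟩
    exact ⟨L, hL, h1, h2, hne⟩

omit [DecidableEq α] in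
/-- In a partial linear space the off-diagonals of distinct lines are disjoint. -/
theorem offDiag_pairwiseDisjoint {lines : Finset (Finset α)}
    (h : IsPartialLinearSpace lines) :
    Set.PairwiseDisjoint (↑lines : Set (Finset α)) Finset.offDiag := by
  intro L₁ hL₁ L₂ hL₂ hne
  rw [Function.onFun, Finset.disjoint_left]
  intro p hp₁ hp₂
  rw [Finset.mem_offDiag] at hp₁ hp₂
  exact hne (h L₁ hL₁ L₂ hL₂ p.1 p.2 hp₁.2.2 hp₁.1 hp₁.2.1 hp₂.1 hp₂.2.1)

/-- **PLS summation (off-diagonal form).**  Summing over the off-diagonal pairs of every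
line equals summing over the collinear pairs, each counted once. -/
theorem sum_lines_offDiag {lines : Finset (Finset α)} (h : IsPartialLinearSpace lines)
    (f : α × α → M) :
    ∑ L ∈ lines, ∑ p ∈ L.offDiag, f p = ∑ p ∈ collinearPairs lines, f p := by
  unfold collinearPairs
  rw [Finset.sum_biUnion (offDiag_pairwiseDisjoint h)]

/-- **PLS summation (bilinear form with vanishing diagonal).**  If the diagonal terms
vanish, the line-by-line full double sums add up to the collinear sum. -/
theorem sum_lines_bilinear {lines : Finset (Finset α)} (h : IsPartialLinearSpace lines)
    (g : α → α → M) (hdiag : ∀ c, g c c = 0) :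
    ∑ L ∈ lines, ∑ c ∈ L, ∑ c' ∈ L, g c c' =
      ∑ p ∈ collinearPairs lines, g p.1 p.2 := by
  rw [← sum_lines_offDiag h (fun p => g p.1 p.2)]
  refine Finset.sum_congr rfl ?_
  intro L _
  rw [← Finset.sum_product', ← Finset.diag_union_offDiag,
    Finset.sum_union (Finset.disjoint_diag_offDiag _), Finset.sum_diag]
  simp [hdiag]

/-- The blocks of a partition (pairwise disjoint lines) form a partial linear space —
the instance used for block systems (LEMMA IMP) and pairings (PAIRING THEOREM). -/
theorem isPartialLinearSpace_of_pairwiseDisjoint {lines : Finset (Finset α)}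
    (hd : Set.PairwiseDisjoint (↑lines : Set (Finset α)) id) :
    IsPartialLinearSpace lines := by
  intro L₁ hL₁ L₂ hL₂ a _ _ ha₁ _ ha₂ _
  by_contra hne
  have := hd hL₁ hL₂ hne
  rw [Function.onFun, id, id, Finset.disjoint_left] at this
  exact this ha₁ ha₂

/-- The "stars" of the Johnson scheme J(m,2): for `i : Fin m`, the star of `i` is the set
of 2-subsets containing `i`.  Two distinct 2-subsets lie in at most one common star (they
share at most one element) — the instance used for `S₅` acting on pairs (door (P₅″)). -/
theorem stars_isPartialLinearSpace (m : ℕ) :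
    IsPartialLinearSpace
      ((Finset.univ : Finset (Fin m)).image
        (fun i => (Finset.univ : Finset (Finset (Fin m))).filter (fun s => s.card = 2 ∧ i ∈ s))) := by
  intro L₁ hL₁ L₂ hL₂ a b hab ha₁ hb₁ ha₂ hb₂
  simp only [Finset.mem_image, Finset.mem_univ, true_and] at hL₁ hL₂
  obtain ⟨i, rfl⟩ := hL₁
  obtain ⟨j, rfl⟩ := hL₂
  simp only [Finset.mem_filter, Finset.mem_univ, true_and] at ha₁ hb₁ ha₂ hb₂
  by_cases hij : i = j
  · subst hij; rfl
  · exfalso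
    -- a and b both contain i and j, have two elements, hence are equal
    have hsub : ∀ s : Finset (Fin m), s.card = 2 → i ∈ s → j ∈ s → s = {i, j} := by
      intro s hs hi hj
      symm
      apply Finset.eq_of_subset_of_card_le
      · intro x hx
        simp only [Finset.mem_insert, Finset.mem_singleton] at hx
        rcases hx with rfl | rfl
        · exact hi
        · exact hj
      · rw [hs, Finset.card_pair hij]
    exact hab ((hsub a ha₁.1 ha₁.2 ha₂.2).trans (hsub b hb₁.1 hb₁.2 hb₂.2).symm)

end Summit.HodgeConjecture.HodgeConjecture.Theorems.HiddenCover
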